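import Literature.MathematicalPhysics.QuantumFieldTheory.Balaban1983to89.B9SectBH1FrameCodedY

/-!
# `Balaban1983to89.B9SectBE4FrameCodedY` — ★★ THE (3.44) MEMBER OF THE SECT.-B STEP OF RECORD IN PRINT's READING (R13-U1), G′ SIDE: the letters-level frame
# `E4Frame₃` (the (v′)-half of `B9SectBGpStepAtLettersV2.E4H2Frame₂`), its step theorem, the family `KSC₆ := {KSC with e4 := KSCU.e4}`, ★★ `e4_transfer_KSC₆`
# (the transfer field PROVED at def-Y's letters), ★★ `e4Frame₃CodedOn`, ★★ `stepE4Pos_KSC₆_on`, ★★ `stepE4Pos_KSCU_on` (pub-ymgap N06 row 13)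

T. Bałaban, *Propagators for lattice gauge theories in a background field*, Commun. Math. Phys. **99** (1985) 389–434
[`Balaban1985BackgroundPropagators`, "B9"]; [4] = T. Bałaban, *Propagators and renormalization transformations for lattice gauge
theories. II*, Commun. Math. Phys. **96** (1984) 223–250 [`Balaban1984PropagatorsII`].

statement-level skeleton of published theorems with citation tags; proofs where landed; nothing here is a claim about the
Yang–Mills mass gap

THE PRINTED LOCI.  Theorem 3.4 p. 400; (3.44) p. 398 (`|(∇_UG′(U)∇*_Uλ)(x)| ≦ B′₀(ε)e^{−δ₀d(y,y′)}(‖λ‖_ε + |λ|)`); p. 403 l. 2–5 (the same for `G′(U′U)` «of course with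
different constants»); (3.3) p. 390, (3.8) p. 392 with (3.5) p. 391 (`∇*_μ = −R(U⁻¹)τ_{−μ}∇_μ`); (3.60)–(3.65) pp. 402–403; [4] (2.51)–(2.52) p. 232, Lemma 2.1 p. 234.

WHY THIS FILE (seat dag-n06-c gen 12; R13-U1).  r06's per-input transfer (v′) of `B9Thm34HolderGpUniformR1.thm34_Gp_holderInput_uniform` — the (3.44)-type
sup entry of `D_l·G′(U′U)·D_s` from the (3.42)₂∕₃ majorants of `D_l·G′(U)`, `G′(U)·D_s` and the sup data `N` of `∇♯_k·G′(U)·D_s` (every `k`) — is packaged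
by `E4H2Frame₂` TOGETHER with the Hölder transfer (vi′); §1 separates the (v′)-half (`E4Frame₃`, output `E4Block`, writing function `wE4 B δc Bε`) and copies the
step theorem; §2 is the family `KSC₆` (g7's augmented `KSC` with the U-letter (3.44) member of `B9SectBCodedReadingsU.KSCU`); §3 proves the transfer field at
def-Y's letters: the output word `∇_{U,μ}G′(U′U)∇*_{U,ν}(f ⊗ E)` on the block of `y` is the `(w, j)`-coordinate family of `(D_l·G′(U′U)·D_s)(coord(f ⊗ E))`
with `D_l = conj b(η⁻¹∇_μ)`, `D_s = conj b(−η⁻¹∇*_ν)` (`norm_symm_gradF_G_negGradB`); the data `N` are READ from the (3.44) block of `KSC₆` at the base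
(`e4_read`; the backward letter on the LEFT by the exact neighbour identity `‖∇*_μΨ(w)‖ ≦ ‖∇_μΨ(w−e_μ)‖`, def-Y's `norm_cdsS_le_norm_cdS_symm_shift`, at the cost
`e^{2(d+1)δc}`); the output is WRITTEN by `Real.iSup_le` ∕ `supBlkS'_le`.  §4 the instance and the steps; the consumer-facing ★★ `stepE4Pos_KSCU_on` has exactly
the binders of `B9SectBStepsKSCUBlocks.stepEPos_KSCU_on` (no new displayed law).
HONEST SCOPE.  Kernel bookkeeping: r06's R1 theorem CALLED, def-Y's letters READ and WRITTEN; nothing of [B9] asserted beyond the landed modules; COUNT-NEUTRAL;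
N06 NOT discharged; one finite lattice programme at fixed ε — nothing continuum, nothing about OS positivity or the mass gap.
-/

noncomputable section

namespace Literature.MathematicalPhysics.QuantumFieldTheory.Balaban1983to89.B9SectBE4FrameCodedY

open B6RandomWalk (HasMajorant hasMajorant_mono BlockSupp)
open B6KLevelCensusIndexV1 (KIdx kGeo)
open B6Ineq2142KLevelV1 (β)
open B9Thm34Ext (toB6)
open B9FromB6 (EBlock E4Block)
open B9Eq352DivFormLetters (conj coordEquiv gradLetterF gradLetterB gradLetterF_apply)
open B9Eq352GradLetters (diffLetter diffLetter_inl diffLetter_inr)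
open B9Thm34SectBUniformR1 (thm34_Gp_uniform)
open B9Thm34HolderGpUniformR1 (thm34_Gp_holderInput_uniform)
open B9SectBGpStepAtLettersV2 (GpFrame₂)
open B9SectBStepWhole (StepPos StepE4Pos)
open B9SectBCodedCarrier (CCfg Coding pullK pullS)
open B9Eq360DeltaPrimeAY (AfldY blkY)
open B9PinMembersKLevelV1 (MemberY geo9Y bg9Y)
open B9SectBGpLettersY (GVal decY coordC blkC GopC letters_base_of_gVal norm_le_one_and_inv_of_mem stencilB_blkC)
open B9SectBGpFrameCodedY (codingYx CplxLettersY Read342Y Write342Y)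
open B9SectBGpReadingsY (KSC baseY etaS_eq_eta read342Y_KSC write342Y_KSC exists_ball_bound)
open B9SectBCodedReadingsU (KSCU KACU)
open B9SectBStepsKSCU (KACU_members_base ineq342_346_347_congr thms_KSCU_base_iff hin_KSCU_on_pos)
open B9SectBGpTransferInY (ineq343_345_congr)
open B9SectBCodedChainOnSubfamily (gpFrame₂CodedOn)
open B9SectBStepPosFamilyTransfer (stepE4Pos_of_family_pos)
open B9GeoLemma21KLevelV1 (geo9Y_dist_triangle geo9Y_len_pos geo9Y_dist_comm)
open B9RWSums347DefiniteFacesWindow (geo9Y_dist_nonneg)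
open B9GeoNormsKLevelModelSignsV1 (modelSignsOn_geo9K)
open Node00 (SiteY BlkY IBondY CfgY BallY SiteParY BondParY BondOpY liftY deltaPrimeAY kernelFamilyS GpY UboxY shiftY etaS cdS cdsS cdS_smul
  supBlkS' toKT)
open Node00.OpsYRead342 (geo9K_len_congr geo9K_dist_congr norm_le_supBlkS')
open Node00.OpsYRead342Cross (norm_cdsS_le_norm_cdS_symm_shift)
open B9Ineq349SiteComposite (cdSL cdsSL cdSL_apply cdsSL_apply etaS_pos supBlkS'_le)
open B9SectBH1ProbesY (Gsc symm_conj_apply symm_G_negGradB norm_coordEquiv_symm_apply_le blockSupp_coordEquiv_liftY)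
open B9SectBH1FrameCodedY (KSC₅)

/-! ## §1 The (3.44) frame: the (v′)-half of `E4H2Frame₂` -/

section Frame

universe u

variable {I : Type} (d : ℕ) (c35 : ℝ) (geo : I → B9.Geometry) (bg : I → B9.Backgrounds)
  (Gp : ∀ i, B9.KernelFamily (geo i) (bg i))
  {𝔸 : Type u} [NormedRing 𝔸] [NormedAlgebra ℂ 𝔸] [CompleteSpace 𝔸] {ι : Type} [Fintype ι] [DecidableEq ι]
  (b : Module.Basis ι ℝ 𝔸) (κ : Type) [Fintype κ]
  (S : I → Type) [∀ i, Fintype (S i)] [∀ i, DecidableEq (S i)]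
  [∀ i, Fintype (geo i).Site] [∀ i, DecidableEq (geo i).Site] [∀ i, Nonempty (geo i).Site]

/-- **THE LETTERS DICTIONARY FOR THE (3.44) BLOCK OF G′, V3** — `GpFrame₂` plus the transfer field for the sup entry (3.44) ALONE: given the (3.42) and (3.44)
blocks of the family at U and r06's per-input transfer (v′) for the family's own `G′(U′U)` (verbatim the (v′) hypothesis of `E4H2Frame₂.e4h2_transfer`), the (3.44)
block of the family holds at U′U with `(wE4 B δc Bε, wE4δ δc)`.  A hypothesis structure; nothing asserted.
[cite: Balaban1985BackgroundPropagators, (3.44) p.398, Thm 3.4 p.400, p.403 l.2–5, (3.65) p.402; Balaban1984PropagatorsII, (2.51)–(2.52) p.232, Lemma 2.1 p.234] -/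
structure E4Frame₃ extends GpFrame₂ c35 geo bg Gp b κ S where
  wE4 : ℝ → ℝ → (ℝ → ℝ) → (ℝ → ℝ)
  wE4δ : ℝ → ℝ
  wE4δ_pos : ∀ δ : ℝ, 0 < δ → 0 < wE4δ δ
  /-- THE TRANSFER: r06's per-input (v′) (inputs at rate δc ≦ δ, outputs at 4δc∕5) for `G′(U′U)` ⇒ the (3.44) block at U′U, given the (3.42) ∕ (3.44) blocks at U
  at rate δ. -/
  e4_transfer : ∀ i (α₀ : ℝ) (U U' : (bg i).Cfg) (α₁ B₀ B δ δc : ℝ) (Bε : ℝ → ℝ),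
    MInv ≤ (geo i).M → 0 < α₀ → (geo i).M * α₀ ≤ aInv → (bg i).Reg335 c35 α₀ U →
    0 < α₁ → α₁ ≤ aW → (bg i).Cplx337 α₁ U U' → 0 < B₀ → 0 ≤ B → 0 < δ → 0 < δc → δc ≤ δ →
    EBlock (Gp i) B₀ δ U → B9FromB6.E4Block (Gp i) Bε δ U →
    (∀ (Dl Ds : Module.End ℝ (S i × ι → ℝ)),
      HasMajorant (g := toB6 (geo i) (Rr i) (Hp i)) (fun p : S i × ι => blk i p.1) (Dl * Gop i U)
        (fun a a' => cR * B₀ * (geo i).len a * Real.exp (-(δc * (geo i).dist a a'))) →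
      HasMajorant (g := toB6 (geo i) (Rr i) (Hp i)) (fun p : S i × ι => blk i p.1) (Gop i U * Ds)
        (fun a a' => cR * B₀ * (geo i).len a * Real.exp (-(δc * (geo i).dist a a'))) →
      ∀ (y' : (geo i).Site) (μ : S i × ι → ℝ) (M : ℝ),
        B6RandomWalk.BlockSupp (g := toB6 (geo i) (Rr i) (Hp i)) (fun p : S i × ι => blk i p.1) μ y' M →
      ∀ (N : ℝ), 0 ≤ N →
        (∀ (k : κ ⊕ κ) (z : S i × ι),
          |(((conj b (diffLetter (T i) (coord i U) ((((geo i).eta : ℂ))⁻¹) k)) * Gop i U * Ds) μ) z| ≤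
            N * Real.exp (-(δc * (geo i).dist (blk i z.1) y'))) →
        (∀ z : S i × ι, |((Dl * Gop i U * Ds) μ) z| ≤ N * Real.exp (-(δc * (geo i).dist (blk i z.1) y'))) →
        ∀ x : S i × ι, |((Dl * Gop i ((bg i).mul U' U) * Ds) μ) x| ≤
          B * (N + M) * Real.exp (-(4 / 5 * δc * (geo i).dist (blk i x.1) y'))) →
    B9FromB6.E4Block (Gp i) (wE4 B δc Bε) (wE4δ δc) ((bg i).mul U' U)

variable {d c35 geo bg Gp b κ S}

/-- ★ **THE (3.44)-STEP OF SECT. B FOR G′(U′U), INHABITED AT THE LETTERS (V3)**: every `E4Frame₃` inhabits `StepE4Pos d c35 geo bg Gp GA Cinv Gp` (output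
`(wE4 B δr Bε, wE4δ δr)`, δr = `rate δ₀`).  Proof = the (v′)-half of V2's `stepE4H2Pos_of_e4h2Frame₂`: r06's R1 `thm34_Gp_holderInput_uniform` (constants `a₁, B`
before the member), `gop_eq`, the transfer field. [cite: Balaban1985BackgroundPropagators, Thm 3.4 p.400 + (3.44) p.398 + p.403 l.2–5; Balaban1984PropagatorsII, Lemma 2.1 p.234] -/
theorem stepE4Pos_of_e4Frame₃ (F : E4Frame₃ c35 geo bg Gp b κ S)
    (GA : ∀ i, B9.KernelFamily (geo i) (bg i)) (Cinv : ∀ i, B9.SiteKernel (geo i) (bg i)) :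
    StepE4Pos d c35 geo bg Gp GA Cinv Gp := by
  intro B₀ δ₀ Bβ Bε Bεβ B₁ δ₁ hB₀ hδ₀ _ _
  have hBG : 0 < F.cR * B₀ := mul_pos F.cR_pos hB₀
  have hδr : 0 < F.rate δ₀ := F.rate_pos hδ₀
  obtain ⟨a₁, ha₁, B, hB, H⟩ := thm34_Gp_holderInput_uniform b κ (F.d261 (F.rate δ₀)) (F.rate δ₀) (F.cR * B₀) F.Cq F.a₀
    F.d₀ F.M₂ (F.Λf (F.rate δ₀)) hBG F.Cq_nonneg F.a₀_nonneg F.M₂_nonneg hδr (fun α hα => F.Λf_one_le _ α hδr hα) F.hrepr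
  refine ⟨F.Mthr (F.rate δ₀), min a₁ F.aW, F.aInv, (F.wE4 B (F.rate δ₀) Bε, F.wE4δ (F.rate δ₀)), F.Mthr_pos _,
    lt_min ha₁ F.aW_pos, F.aInv_pos, F.wE4δ_pos _ hδr, ?_⟩
  intro i hM0 α₀ hα₀ hMa U hU hT α₁ hα₁ ha U' hU'
  have hM : F.MInv ≤ (geo i).M := F.MInv_le_of_Mthr_le hM0
  obtain ⟨hΔG, hGΔ⟩ := F.reg_inv i α₀ U hM hα₀ hMa hU
  obtain ⟨h1, h2, h3, -⟩ := F.read342_le i α₀ U hM hα₀ hMa hU hB₀ hδ₀ (F.rate_le δ₀) hT.1.1.1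
  obtain ⟨hkF, hsF, h337s, h337F, h337B, hA, hAτ⟩ := F.cplx i α₁ U U' hα₁ hU'
  obtain ⟨hinv1, hinv2, hv, -⟩ := H (F.T i) (F.coord i U) (F.blk i) (F.kQ i U) (F.sQ i U) (F.cfun i) (F.w i U)
    (F.dist_nonneg i) (F.triangle i) (F.dist_self i) (F.dist_comm i) (F.len_pos i) (F.eta_le_len i) (F.eta_pos i)
    (F.h261_of i hδr (F.rate_le_cap δ₀) hM0) (F.hST_of i hδr (F.rate_le_cap δ₀) hM0) (F.unitary i U)
    (F.stencilB i) (F.stencilF i) (F.stencil0 i) (F.w_nonneg i U) (F.card_w i U) (F.hkQ i U) (F.hsQ i U) (F.hcfun i)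
    hΔG hGΔ h1 h2 h3 α₁ hα₁.le (le_trans ha (min_le_left _ _)) (F.expA i U U') (F.kF i U U') (F.sF i U U')
    hkF hsF h337s h337F h337B hA hAτ
  have hG := F.gop_eq i ((bg i).mul U' U) _ _ (F.mul_law i α₁ U U' hα₁ hU') hinv1 hinv2
  rw [← hG] at hv
  exact F.e4_transfer i α₀ U U' α₁ B₀ B δ₀ (F.rate δ₀) Bε hM hα₀ hMa hU hα₁ (le_trans ha (min_le_right _ _)) hU'
    hB₀ hB hδ₀ hδr (F.rate_le δ₀) hT.1.1.1 hT.1.2.2.1 hv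

end Frame

/-! ## §2 The family `KSC₆` (augmented (3.42) reading, U-letter (3.44) member) and its (3.42) dictionaries -/

variable {d ℓ : ℕ} {hd : 1 ≤ d + 1} {hL : Odd (ℓ + 1) ∧ 1 < ℓ + 1} {b₀ b₁ : ℝ} {Mstar : ℕ}
variable {𝔸 : Type} [NormedRing 𝔸] [NormedAlgebra ℂ 𝔸] [CompleteSpace 𝔸] [FiniteDimensional ℝ 𝔸]

section Family

variable (G : Subgroup 𝔸ˣ) (x : MemberY d ℓ hd hL b₀ b₁ Mstar) (par : SiteParY 𝔸 x.toKIdx) {ι : Type} [Fintype ι] (b : Module.Basis ι ℝ 𝔸)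
  (ιB : BlkY x.toKIdx → IBondY x.toKIdx) (C37 C38 : ℝ → CfgY 𝔸 x.toKIdx → AfldY 𝔸 x.toKIdx → Prop)

/-- ★ **`KSC₆`** — g7's augmented coded reading `KSC` with the (3.44) member REPLACED by the U-letter one of `KSCU` (the differences of `base c` around `G′(dec c)`).
[cite: Balaban1985BackgroundPropagators, (3.42) p.397, (3.44) p.398, Thm 3.4 p.400, p.403 l.2–5] -/
def KSC₆ : B9.KernelFamily (geo9Y x) (codingYx G x C37 C38).bg :=
  { KSC G x par C37 C38 with e4 := (KSCU G x par C37 C38).e4 }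

omit [FiniteDimensional ℝ 𝔸] in
/-- the (3.42) member of `KSC₆` is `KSC`'s (`rfl`). [cite: Balaban1985BackgroundPropagators, (3.42) p.397, bookkeeping] -/
theorem KSC₆_e : (KSC₆ G x par C37 C38).e = (KSC G x par C37 C38).e := rfl

omit [FiniteDimensional ℝ 𝔸] in
/-- the (3.44) member of `KSC₆` is `KSCU`'s (`rfl`). [cite: Balaban1985BackgroundPropagators, (3.44) p.398, bookkeeping] -/
theorem KSC₆_e4 : (KSC₆ G x par C37 C38).e4 = (KSCU G x par C37 C38).e4 := rfl

omit [FiniteDimensional ℝ 𝔸] in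
/-- the (3.44) member of `KSC₆` on site arguments: `sup_E sup_μ sup_{w ∈ Δ, ν} ‖(∇_{U,μ}G′(dec c)∇*_{U,ν}(f ⊗ E))(w)‖`, `U = base c` (`rfl`).
[cite: Balaban1985BackgroundPropagators, (3.44) p.398, p.403 l.2–5, bookkeeping] -/
theorem KSC₆_e4_inl (c : (codingYx G x C37 C38).bg.Cfg) (f : SiteY x.toKIdx → ℝ) (bb : IBondY x.toKIdx) :
    (KSC₆ G x par C37 C38).e4 c (.inl f) bb =
      ⨆ E : BallY 𝔸, ⨆ μ : Fin (d + 1), supBlkS' x.toKIdx (β x.toKIdx.hN x.toKIdx.D x.toKIdx.hk bb)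
        (fun ν => cdS x.toKIdx (baseY x.toKIdx c) μ (GpY x.toKIdx par (decY x.toKIdx c) (cdsS x.toKIdx (baseY x.toKIdx c) ν (liftY f (E : 𝔸))))) := rfl

omit [FiniteDimensional ℝ 𝔸] in
/-- the (3.44) member of `KSC₆` vanishes on bond-sector arguments (`rfl`). [cite: Balaban1985BackgroundPropagators, (3.44) p.398, bookkeeping] -/
theorem KSC₆_e4_inr (c : (codingYx G x C37 C38).bg.Cfg) (J : Node00.FBondY x.toKIdx → ℝ) (bb : IBondY x.toKIdx) :
    (KSC₆ G x par C37 C38).e4 c (.inr J) bb = 0 := rfl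

omit [FiniteDimensional ℝ 𝔸] in
/-- the (3.42) block of `KSC₆` IS that of `KSC`. [cite: Balaban1985BackgroundPropagators, (3.42) p.397, bookkeeping] -/
theorem eBlock_KSC₆_iff {B₀ δ : ℝ} (c : (codingYx G x C37 C38).bg.Cfg) :
    EBlock (KSC₆ G x par C37 C38) B₀ δ c ↔ EBlock (KSC G x par C37 C38) B₀ δ c := by
  rw [EBlock, EBlock, KSC₆_e]

omit [FiniteDimensional ℝ 𝔸] in
/-- the (3.44) block of `KSC₆` IS that of `KSCU`. [cite: Balaban1985BackgroundPropagators, (3.44) p.398, bookkeeping] -/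
theorem e4Block_KSC₆_iff {Bε : ℝ → ℝ} {δ : ℝ} (c : (codingYx G x C37 C38).bg.Cfg) :
    E4Block (KSC₆ G x par C37 C38) Bε δ c ↔ E4Block (KSCU G x par C37 C38) Bε δ c := by
  rw [E4Block, E4Block, KSC₆_e4]

omit [FiniteDimensional ℝ 𝔸] in
/-- at a BASE configuration every member of `KSC₆` is `KSC`'s (`dec (base U) = base (base U) = U`). [cite: Balaban1985BackgroundPropagators, (3.42)–(3.47) pp.397–398, bookkeeping] -/
theorem KSC₆_members_base (U : CfgY 𝔸 x.toKIdx) :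
    (∀ n, (KSC₆ G x par C37 C38).e n (.base U) = (KSC G x par C37 C38).e n (.base U)) ∧
    (KSC₆ G x par C37 C38).h1 (.base U) = (KSC G x par C37 C38).h1 (.base U) ∧
    (KSC₆ G x par C37 C38).e4 (.base U) = (KSC G x par C37 C38).e4 (.base U) ∧
    (KSC₆ G x par C37 C38).h2 (.base U) = (KSC G x par C37 C38).h2 (.base U) ∧
    (∀ n, (KSC₆ G x par C37 C38).l2 n (.base U) = (KSC G x par C37 C38).l2 n (.base U)) ∧
    (∀ n, (KSC₆ G x par C37 C38).glob n (.base U) = (KSC G x par C37 C38).glob n (.base U)) := by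
  refine ⟨fun _ => rfl, rfl, ?_, rfl, fun _ => rfl, fun _ => rfl⟩
  funext lam bb
  rcases lam with f | J <;> rfl

variable [Fintype (geo9Y x).Site]

/-- the (3.42) reading dictionary of `KSC₆` is `KSC`'s. [cite: Balaban1985BackgroundPropagators, (3.42) p.397; Balaban1984PropagatorsII, (2.51) p.232] -/
theorem read342Y_KSC₆ (hι : ∀ s : BlkY x.toKIdx, β x.toKIdx.hN x.toKIdx.D x.toKIdx.hk (ιB s) = s)
    (M₂ : ℝ) (hM₂ : 0 ≤ M₂) (hrepr : ∀ (v : 𝔸) (j : ι), |b.repr v j| ≤ M₂ * ‖v‖) (c35 MInv aInv : ℝ) :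
    Read342Y G x par b ιB C37 C38 (KSC₆ G x par C37 C38) c35 (M₂ * ∑ j, ‖b j‖) MInv aInv 0 True :=
  fun α₀ U B₀ δ hM hα₀ hMa hreg hB₀ hδ hE =>
    read342Y_KSC G x par b ιB C37 C38 hι M₂ hM₂ hrepr c35 MInv aInv α₀ U B₀ δ hM hα₀ hMa hreg hB₀ hδ ((eBlock_KSC₆_iff G x par C37 C38 _).1 hE)

omit [FiniteDimensional ℝ 𝔸] in
/-- the (3.42) writing dictionary of `KSC₆` is `KSC`'s. [cite: Balaban1985BackgroundPropagators, (3.42) p.397, p.403; Balaban1984PropagatorsII, (2.51) p.232] -/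
theorem write342Y_KSC₆ (hι : ∀ s : BlkY x.toKIdx, β x.toKIdx.hN x.toKIdx.D x.toKIdx.hk (ιB s) = s)
    (M₂ : ℝ) (hM₂ : 0 ≤ M₂) (hrepr : ∀ (v : 𝔸) (j : ι), |b.repr v j| ≤ M₂ * ‖v‖) (aW : ℝ) (hC37 : ∀ β' U a, C37 β' U a → GVal G x.toKIdx U) :
    Write342Y G x par b ιB C37 C38 (KSC₆ G x par C37 C38) (fun B _ => (M₂ * ∑ j, ‖b j‖) * B + 1) (fun δ => δ) aW 0 True :=
  fun U a α₁ B δ hα₁ hα₁W h37 hB hδ hG hDG hGD hLG =>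
    (eBlock_KSC₆_iff G x par C37 C38 _).2 (write342Y_KSC G x par b ιB C37 C38 hι M₂ hM₂ hrepr aW hC37 U a α₁ B δ hα₁ hα₁W h37 hB hδ hG hDG hGD hLG)

end Family

/-! ## §3 Tools: the triple letter product read back as def-Y's (3.44) word, coordinates, the (3.44) block READ -/

section Tools

variable [NormOneClass 𝔸] (c35 : ℝ) (G : Subgroup 𝔸ˣ) (x : MemberY d ℓ hd hL b₀ b₁ Mstar) (par : SiteParY 𝔸 x.toKIdx) {ι : Type} [Fintype ι]
  (b : Module.Basis ι ℝ 𝔸) (ιB : BlkY x.toKIdx → IBondY x.toKIdx) [Fintype (geo9Y x).Site]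
  (C37 C38 : ℝ → CfgY 𝔸 x.toKIdx → AfldY 𝔸 x.toKIdx → Prop)

omit [CompleteSpace 𝔸] [FiniteDimensional ℝ 𝔸] [NormOneClass 𝔸] [Fintype (geo9Y x).Site] in
/-- a coordinate is at most `M₂` times the norm of the vector: `|v(w,j)| ≦ M₂‖(coord⁻¹v)(w)‖`. [cite: Balaban1984PropagatorsII, (2.51) p.232, bookkeeping] -/
theorem abs_apply_le_norm_symm {M₂ : ℝ} (hrepr : ∀ (v : 𝔸) (j : ι), |b.repr v j| ≤ M₂ * ‖v‖) (v : SiteY x.toKIdx × ι → ℝ)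
    (p : SiteY x.toKIdx × ι) : |v p| ≤ M₂ * ‖(coordEquiv b).symm v p.1‖ := by
  have h : v p = b.repr ((coordEquiv b).symm v p.1) p.2 := by
    conv_lhs => rw [← (coordEquiv b).apply_symm_apply v]
    rfl
  rw [h]
  exact hrepr _ _

omit [FiniteDimensional ℝ 𝔸] [NormOneClass 𝔸] [Fintype (geo9Y x).Site] in
/-- ★ **THE TRIPLE LETTER PRODUCT `D_l·(η²T)·D_s` READ BACK, forward letter on the left**: `‖coord⁻¹((conj b(η⁻¹∇_μ) * conj b(η²T) * conj b(−η⁻¹∇*_ν)) v)(w)‖ =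
‖(∇_{U,μ}T∇*_{U,ν}(coord⁻¹v))(w)‖` (the scalars `η⁻¹·η²·η⁻¹` cancel — (3.44) carries the prefactor `η⁰`).
[cite: Balaban1985BackgroundPropagators, (3.44) p.398, (3.3) p.390, (3.8) p.392; Balaban1984PropagatorsII, (2.51)–(2.52) p.232] -/
theorem norm_symm_gradF_G_negGradB (T : (SiteY x.toKIdx → 𝔸) →ₗ[ℂ] (SiteY x.toKIdx → 𝔸)) (U : CfgY 𝔸 x.toKIdx) (μ ν : Fin (d + 1))
    (v : SiteY x.toKIdx × ι → ℝ) (w : SiteY x.toKIdx) :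
    ‖(coordEquiv b).symm ((conj b (gradLetterF (shiftY x.toKIdx) (UboxY x.toKIdx U) ((((etaS x.toKIdx : ℝ) : ℂ))⁻¹) μ) * conj b (Gsc x.toKIdx T) *
        conj b (-gradLetterB (shiftY x.toKIdx) (UboxY x.toKIdx U) ((((etaS x.toKIdx : ℝ) : ℂ))⁻¹) ν)) v) w‖ =
      ‖cdS x.toKIdx U μ (T (cdsS x.toKIdx U ν ((coordEquiv b).symm v))) w‖ := by
  have hη : ((etaS x.toKIdx : ℝ) : ℂ) ≠ 0 := by exact_mod_cast (etaS_pos x.toKIdx).ne'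
  rw [mul_assoc, Module.End.mul_apply, symm_conj_apply, symm_G_negGradB]
  show ‖((((etaS x.toKIdx : ℝ) : ℂ))⁻¹) • B9Eq39Adjoint.covD (shiftY x.toKIdx) (UboxY x.toKIdx U) μ
      (-((((etaS x.toKIdx : ℝ) : ℂ)) • T (cdsS x.toKIdx U ν ((coordEquiv b).symm v)))) w‖ = _
  have hc : B9Eq39Adjoint.covD (shiftY x.toKIdx) (UboxY x.toKIdx U) μ
      (-((((etaS x.toKIdx : ℝ) : ℂ)) • T (cdsS x.toKIdx U ν ((coordEquiv b).symm v)))) w =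
      -((((etaS x.toKIdx : ℝ) : ℂ)) • cdS x.toKIdx U μ (T (cdsS x.toKIdx U ν ((coordEquiv b).symm v))) w) := by
    have h1 : cdS x.toKIdx U μ (-((((etaS x.toKIdx : ℝ) : ℂ)) • T (cdsS x.toKIdx U ν ((coordEquiv b).symm v)))) =
        -((((etaS x.toKIdx : ℝ) : ℂ)) • cdS x.toKIdx U μ (T (cdsS x.toKIdx U ν ((coordEquiv b).symm v)))) := by
      rw [← cdSL_apply, map_neg, map_smul, cdSL_apply]
    exact congrFun h1 w
  rw [hc, smul_neg, norm_neg, smul_smul, inv_mul_cancel₀ hη, one_smul]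

omit [FiniteDimensional ℝ 𝔸] [NormOneClass 𝔸] [Fintype (geo9Y x).Site] in
/-- ★ **THE TRIPLE LETTER PRODUCT, backward letter on the left**: `‖coord⁻¹((conj b(−η⁻¹∇*_μ) * conj b(η²T) * conj b(−η⁻¹∇*_ν)) v)(w)‖ = ‖(∇*_{U,μ}T∇*_{U,ν}(coord⁻¹v))(w)‖`.
[cite: Balaban1985BackgroundPropagators, (3.8) p.392, (3.44) p.398 (not a printed orientation); Balaban1984PropagatorsII, (2.51)–(2.52) p.232] -/
theorem norm_symm_negGradB_G_negGradB (T : (SiteY x.toKIdx → 𝔸) →ₗ[ℂ] (SiteY x.toKIdx → 𝔸)) (U : CfgY 𝔸 x.toKIdx) (μ ν : Fin (d + 1))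
    (v : SiteY x.toKIdx × ι → ℝ) (w : SiteY x.toKIdx) :
    ‖(coordEquiv b).symm ((conj b (-gradLetterB (shiftY x.toKIdx) (UboxY x.toKIdx U) ((((etaS x.toKIdx : ℝ) : ℂ))⁻¹) μ) * conj b (Gsc x.toKIdx T) *
        conj b (-gradLetterB (shiftY x.toKIdx) (UboxY x.toKIdx U) ((((etaS x.toKIdx : ℝ) : ℂ))⁻¹) ν)) v) w‖ =
      ‖cdsS x.toKIdx U μ (T (cdsS x.toKIdx U ν ((coordEquiv b).symm v))) w‖ := by
  have hη : ((etaS x.toKIdx : ℝ) : ℂ) ≠ 0 := by exact_mod_cast (etaS_pos x.toKIdx).ne'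
  rw [mul_assoc, Module.End.mul_apply, symm_conj_apply, symm_G_negGradB, LinearMap.neg_apply, Pi.neg_apply, norm_neg]
  show ‖((((etaS x.toKIdx : ℝ) : ℂ))⁻¹) • B9Eq39Adjoint.covDstar (shiftY x.toKIdx) (UboxY x.toKIdx U) μ
      (-((((etaS x.toKIdx : ℝ) : ℂ)) • T (cdsS x.toKIdx U ν ((coordEquiv b).symm v)))) w‖ = _
  have hc : B9Eq39Adjoint.covDstar (shiftY x.toKIdx) (UboxY x.toKIdx U) μ
      (-((((etaS x.toKIdx : ℝ) : ℂ)) • T (cdsS x.toKIdx U ν ((coordEquiv b).symm v)))) w =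
      -((((etaS x.toKIdx : ℝ) : ℂ)) • cdsS x.toKIdx U μ (T (cdsS x.toKIdx U ν ((coordEquiv b).symm v))) w) := by
    have h1 : cdsS x.toKIdx U μ (-((((etaS x.toKIdx : ℝ) : ℂ)) • T (cdsS x.toKIdx U ν ((coordEquiv b).symm v)))) =
        -((((etaS x.toKIdx : ℝ) : ℂ)) • cdsS x.toKIdx U μ (T (cdsS x.toKIdx U ν ((coordEquiv b).symm v)))) := by
      rw [← cdsSL_apply, map_neg, map_smul, cdsSL_apply]
    exact congrFun h1 w
  rw [hc, smul_neg, norm_neg, smul_smul, inv_mul_cancel₀ hη, one_smul]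

omit [NormOneClass 𝔸] [Fintype (geo9Y x).Site] in
/-- ★ **THE (3.44) BLOCK OF `KSCU` AT A BASE, READ POINTWISE**: `‖(∇_{U,μ}G′(U)∇*_{U,ν}(f ⊗ E))(w)‖ ≦ B_ε(ε)·e^{−δd(y,y′)}·(‖f‖_ε + |f|)` for `w ∈ Δ(βy)`,
`supp f ⊂ Δ(βy′)`, `‖E‖ ≦ 1`, `0 < ε ≦ 1` (the integrand is below its `⨆` — bounded over the unit ball by finite-dimensionality, `exists_ball_bound`).
[cite: Balaban1985BackgroundPropagators, (3.44) p.398] -/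
theorem e4_read {Bε : ℝ → ℝ} {δ : ℝ} {U : CfgY 𝔸 x.toKIdx} (hE4 : E4Block (KSCU G x par C37 C38) Bε δ (.base U))
    {ε : ℝ} (hε0 : 0 < ε) (hε1 : ε ≤ 1) (f : SiteY x.toKIdx → ℝ) (y y' : IBondY x.toKIdx) (hs : (geo9Y x).suppIn (Sum.inl f) y')
    (E : BallY 𝔸) (μ ν : Fin (d + 1)) {w : SiteY x.toKIdx} (hw : blkY x.toKIdx w = β x.toKIdx.hN x.toKIdx.D x.toKIdx.hk y) :
    ‖cdS x.toKIdx U μ (GpY x.toKIdx par U (cdsS x.toKIdx U ν (liftY f (E : 𝔸)))) w‖ ≤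
      Bε ε * Real.exp (-(δ * (geo9Y x).dist y y')) * ((geo9Y x).holder ε (Sum.inl f) + (geo9Y x).supNorm (Sum.inl f)) := by
  have h := hE4 ε (Sum.inl f) y y' hε0 hε1 hs
  rw [← KSC₆_e4, KSC₆_e4_inl] at h
  refine le_trans ?_ h
  -- the bound over the unit ball, uniform in the directions
  have hC : ∀ μ' ν' : Fin (d + 1), ∃ C : ℝ, 0 ≤ C ∧ ∀ (E' : BallY 𝔸) (z : SiteY x.toKIdx),
      ‖((cdSL x.toKIdx U μ' ∘ₗ GpY x.toKIdx par U ∘ₗ cdsSL x.toKIdx U ν').restrictScalars ℝ) (liftY f (E' : 𝔸)) z‖ ≤ C := fun μ' ν' =>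
    exists_ball_bound x _ f
  choose C hC0 hCb using hC
  have hbdd : BddAbove (Set.range fun E' : BallY 𝔸 => ⨆ μ' : Fin (d + 1), supBlkS' x.toKIdx (β x.toKIdx.hN x.toKIdx.D x.toKIdx.hk y)
      (fun ν' => cdS x.toKIdx U μ' (GpY x.toKIdx par U (cdsS x.toKIdx U ν' (liftY f (E' : 𝔸)))))) := by
    refine ⟨∑ μ', ∑ ν', C μ' ν', ?_⟩
    rintro _ ⟨E', rfl⟩
    have hS : 0 ≤ ∑ μ', ∑ ν', C μ' ν' := Finset.sum_nonneg fun μ' _ => Finset.sum_nonneg fun ν' _ => hC0 μ' ν'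
    refine Real.iSup_le (fun μ' => ?_) hS
    refine supBlkS'_le x.toKIdx _ _ hS fun z ν' _ => ?_
    refine le_trans ?_ (Finset.single_le_sum (f := fun μ'' => ∑ ν', C μ'' ν') (fun _ _ => Finset.sum_nonneg fun ν' _ => hC0 _ ν') (Finset.mem_univ μ'))
    refine le_trans ?_ (Finset.single_le_sum (f := fun ν'' => C μ' ν'') (fun _ _ => hC0 _ _) (Finset.mem_univ ν'))
    exact hCb μ' ν' E' z
  refine le_trans ?_ (le_ciSup hbdd E)
  refine le_trans ?_ (le_ciSup (f := fun μ' : Fin (d + 1) => supBlkS' x.toKIdx (β x.toKIdx.hN x.toKIdx.D x.toKIdx.hk y)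
    (fun ν' => cdS x.toKIdx U μ' (GpY x.toKIdx par U (cdsS x.toKIdx U ν' (liftY f (E : 𝔸)))))) (Finite.bddAbove_range _) μ)
  exact norm_le_supBlkS' x.toKIdx _ (fun ν' => cdS x.toKIdx U μ (GpY x.toKIdx par U (cdsS x.toKIdx U ν' (liftY f (E : 𝔸))))) ν hw

end Tools

/-! ## §4 ★★ The transfer field PROVED for `KSC₆`, the instance, the (3.44) block-steps -/

section Transfer

variable [NormOneClass 𝔸] (c35 : ℝ) (G : Subgroup 𝔸ˣ) (x : MemberY d ℓ hd hL b₀ b₁ Mstar) (par : SiteParY 𝔸 x.toKIdx) {ι : Type} [Fintype ι]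
  (b : Module.Basis ι ℝ 𝔸) (ιB : BlkY x.toKIdx → IBondY x.toKIdx) [Fintype (geo9Y x).Site]
  (C37 C38 : ℝ → CfgY 𝔸 x.toKIdx → AfldY 𝔸 x.toKIdx → Prop)

/-- the output writing function: `wE4 B δc Bε ε = (Σ‖b_j‖)·B·M₂·(B⁺_ε·e^{2(d+1)δc} + 1)`, `B⁺_ε = max (Bε ε) 0`.
[cite: Balaban1985BackgroundPropagators, (3.44) p.398, p.403 l.2–5 («of course with different constants»)] -/
def wE4₆ (dd Sb M₂ : ℝ) (B δc : ℝ) (Bε : ℝ → ℝ) : ℝ → ℝ := fun ε => Sb * B * M₂ * (max (Bε ε) 0 * Real.exp (δc * dd) + 1)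

omit [NormedAlgebra ℂ 𝔸] [CompleteSpace 𝔸] [FiniteDimensional ℝ 𝔸] [NormOneClass 𝔸] in
/-- `0 ≤ wE4₆` for nonnegative data. [cite: Balaban1985BackgroundPropagators, (3.44) p.398, bookkeeping] -/
theorem wE4₆_nonneg {dd Sb M₂ B δc : ℝ} (Bε : ℝ → ℝ) (hSb : 0 ≤ Sb) (hB : 0 ≤ B) (hM₂ : 0 ≤ M₂) (ε : ℝ) : 0 ≤ wE4₆ dd Sb M₂ B δc Bε ε := by
  unfold wE4₆
  have h0 : 0 ≤ max (Bε ε) 0 := le_max_right _ _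
  positivity

omit [NormOneClass 𝔸] in
set_option maxHeartbeats 800000 in
/-- ★★ **THE TRANSFER FIELD OF THE (3.44) FRAME, PROVED FOR `KSC₆` AT def-Y's LETTERS**: from r06's per-input transfer (v′) for the letters of the member (hypothesis
`HV`, the shape of `E4Frame₃.e4_transfer`), the (3.42) majorants at the base (`hread`), the (3.44) block of `KSC₆` at the base, unit norms of the bond variables
(`G`-valued base): the (3.44) block of `KSC₆` at the coded product with `(wE4₆ … B δc Bε, 4δc∕5)`.  For the output word `∇_{U,μ}G′(U′U)∇*_{U,ν}(f ⊗ E)` at `w`: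
`D_l := conj b(η⁻¹∇_μ)`, `D_s := conj b(−η⁻¹∇*_ν)`, input `coord(f ⊗ E)` (supported in the labelled block of `supp f`, `|·| ≦ M₂|f|`), data
`N := M₂·B⁺_ε·e^{2(d+1)δc}·(‖f‖_ε + |f|)` read from the (3.44) block at the base (backward letters on the left through `‖∇*_μΨ(w)‖ ≦ ‖∇_μΨ(w−e_μ)‖`).
[cite: Balaban1985BackgroundPropagators, Thm 3.4 p.400, (3.44) p.398, p.403 l.2–5, (3.3) p.390, (3.8) p.392; Balaban1984PropagatorsII, (2.51)–(2.52) p.232, (2.54) p.233] -/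
theorem e4_transfer_KSC₆ (hι : ∀ s : BlkY x.toKIdx, β x.toKIdx.hN x.toKIdx.D x.toKIdx.hk (ιB s) = s)
    (hG1 : ∀ u : 𝔸ˣ, u ∈ G → ‖(u : 𝔸)‖ ≤ 1)
    {M₂ : ℝ} (hM₂ : 0 ≤ M₂) (hrepr : ∀ (v : 𝔸) (j : ι), |b.repr v j| ≤ M₂ * ‖v‖)
    {MInv cR aInv aW : ℝ} (hcR : 0 < cR) (hread : Read342Y G x par b ιB C37 C38 (KSC₆ G x par C37 C38) c35 cR MInv aInv 0 True)
    (α₀ : ℝ) (c c' : (codingYx G x C37 C38).bg.Cfg) (α₁ B₀ B δ δc : ℝ) (Bε : ℝ → ℝ)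
    (hM : MInv ≤ (geo9Y x).M) (hα₀ : 0 < α₀) (hMa : (geo9Y x).M * α₀ ≤ aInv) (hreg : (codingYx G x C37 C38).bg.Reg335 c35 α₀ c)
    (_hα₁ : 0 < α₁) (_haW : α₁ ≤ aW) (h37 : (codingYx G x C37 C38).bg.Cplx337 α₁ c c') (hB₀ : 0 < B₀) (hB : 0 ≤ B)
    (hδ : 0 < δ) (hδc : 0 < δc) (hδcδ : δc ≤ δ)
    (hE : EBlock (KSC₆ G x par C37 C38) B₀ δ c) (hE4 : E4Block (KSC₆ G x par C37 C38) Bε δ c)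
    (HV : ∀ (Dl Ds : Module.End ℝ (SiteY x.toKIdx × ι → ℝ)),
      HasMajorant (g := toB6 (geo9Y x) (0 : ℝ) True) (fun p : SiteY x.toKIdx × ι => blkC x.toKIdx ιB p.1) (Dl * GopC x.toKIdx par b c)
        (fun a a' => cR * B₀ * (geo9Y x).len a * Real.exp (-(δc * (geo9Y x).dist a a'))) →
      HasMajorant (g := toB6 (geo9Y x) (0 : ℝ) True) (fun p : SiteY x.toKIdx × ι => blkC x.toKIdx ιB p.1) (GopC x.toKIdx par b c * Ds)
        (fun a a' => cR * B₀ * (geo9Y x).len a * Real.exp (-(δc * (geo9Y x).dist a a'))) →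
      ∀ (y' : IBondY x.toKIdx) (μ : SiteY x.toKIdx × ι → ℝ) (M : ℝ),
        BlockSupp (g := toB6 (geo9Y x) (0 : ℝ) True) (fun p : SiteY x.toKIdx × ι => blkC x.toKIdx ιB p.1) μ y' M →
      ∀ (N : ℝ), 0 ≤ N →
        (∀ (k : Fin (d + 1) ⊕ Fin (d + 1)) (z : SiteY x.toKIdx × ι),
          |(((conj b (diffLetter (shiftY x.toKIdx) (coordC G x.toKIdx c) ((((geo9Y x).eta : ℂ))⁻¹) k)) * GopC x.toKIdx par b c * Ds) μ) z| ≤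
            N * Real.exp (-(δc * (geo9Y x).dist (blkC x.toKIdx ιB z.1) y'))) →
        (∀ z : SiteY x.toKIdx × ι, |((Dl * GopC x.toKIdx par b c * Ds) μ) z| ≤ N * Real.exp (-(δc * (geo9Y x).dist (blkC x.toKIdx ιB z.1) y'))) →
        ∀ p : SiteY x.toKIdx × ι, |((Dl * GopC x.toKIdx par b ((codingYx G x C37 C38).bg.mul c' c) * Ds) μ) p| ≤
          B * (N + M) * Real.exp (-(4 / 5 * δc * (geo9Y x).dist (blkC x.toKIdx ιB p.1) y'))) :
    E4Block (KSC₆ G x par C37 C38) (wE4₆ (2 * ((d : ℝ) + 1)) (∑ j, ‖b j‖) M₂ B δc Bε) (4 / 5 * δc) ((codingYx G x C37 C38).bg.mul c' c) := by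
  classical
  letI : Fintype (B9GeoNormsKLevelV1.geo9K x.toKIdx).Site := ‹Fintype (geo9Y x).Site›
  obtain ⟨U, a, rfl, rfl, hCa⟩ := (codingYx G x C37 C38).exists_of_bg_Cplx337 h37
  have hU335 : (bg9Y 𝔸 G x).Reg335 c35 α₀ U := by
    obtain ⟨U', h1, h2⟩ := (codingYx G x C37 C38).exists_of_bg_Reg335 hreg
    cases h1
    exact h2
  have hU : GVal G x.toKIdx U := hU335.1.1
  set Sb : ℝ := ∑ j, ‖b j‖ with hSb
  have hSb0 : 0 ≤ Sb := Finset.sum_nonneg fun j _ => norm_nonneg _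
  set TU : (SiteY x.toKIdx → 𝔸) →ₗ[ℂ] (SiteY x.toKIdx → 𝔸) := GpY x.toKIdx par U with hTU
  set TW : (SiteY x.toKIdx → 𝔸) →ₗ[ℂ] (SiteY x.toKIdx → 𝔸) := GpY x.toKIdx par (decY x.toKIdx (.prod U a)) with hTW
  have hco : coordC G x.toKIdx (.base U) = UboxY x.toKIdx U := (letters_base_of_gVal G x.toKIdx par hU).1
  have hGopU : GopC x.toKIdx par b (.base U) = conj b (Gsc x.toKIdx TU) := by
    show conj b (((kGeo x.toKIdx).eta ^ 2) • (GpY x.toKIdx par U).restrictScalars ℝ) = conj b ((etaS x.toKIdx ^ 2) • TU.restrictScalars ℝ)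
    rw [etaS_eq_eta]
  have hGopW : GopC x.toKIdx par b ((codingYx G x C37 C38).bg.mul (.mult a) (.base U)) = conj b (Gsc x.toKIdx TW) := by
    show conj b (((kGeo x.toKIdx).eta ^ 2) • (GpY x.toKIdx par (decY x.toKIdx (.prod U a))).restrictScalars ℝ) =
      conj b ((etaS x.toKIdx ^ 2) • TW.restrictScalars ℝ)
    rw [etaS_eq_eta]
  have hDk : ∀ k : Fin (d + 1) ⊕ Fin (d + 1),
      diffLetter (shiftY x.toKIdx) (coordC G x.toKIdx (.base U)) ((((geo9Y x).eta : ℂ))⁻¹) k =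
        diffLetter (shiftY x.toKIdx) (UboxY x.toKIdx U) ((((etaS x.toKIdx : ℝ) : ℂ))⁻¹) k := by
    intro k
    show diffLetter (shiftY x.toKIdx) (coordC G x.toKIdx (.base U)) ((((kGeo x.toKIdx).eta : ℝ) : ℂ))⁻¹ k = _
    rw [hco, etaS_eq_eta]
  have hUu : ∀ (μ : Fin (d + 1)) (w : SiteY x.toKIdx), ‖((UboxY x.toKIdx U μ w : 𝔸ˣ) : 𝔸)‖ ≤ 1 ∧ ‖(((UboxY x.toKIdx U μ w)⁻¹ : 𝔸ˣ) : 𝔸)‖ ≤ 1 :=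
    fun μ w => norm_le_one_and_inv_of_mem G hG1 (hU μ _)
  have hdd : 0 ≤ 2 * ((d : ℝ) + 1) := by positivity
  -- the (3.42) majorants at the base, lowered to the call rate
  obtain ⟨-, hm1, hm2, -⟩ := hread α₀ U B₀ δ hM hα₀ hMa hU335 hB₀ hδ hE
  have hlow : ∀ a a' : IBondY x.toKIdx, cR * B₀ * (geo9Y x).len a * Real.exp (-(δ * (geo9Y x).dist a a')) ≤
      cR * B₀ * (geo9Y x).len a * Real.exp (-(δc * (geo9Y x).dist a a')) := fun a a' =>
    mul_le_mul_of_nonneg_left (Real.exp_le_exp.2 (by nlinarith [geo9Y_dist_nonneg x a a'])) (mul_nonneg (mul_pos hcR hB₀).le (geo9Y_len_pos x a).le)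
  -- the output block
  intro ε lam y y' hε0 hε1 hlam
  have hW : 0 ≤ wE4₆ (2 * ((d : ℝ) + 1)) Sb M₂ B δc Bε ε := wE4₆_nonneg Bε hSb0 hB hM₂ ε
  have hHS : 0 ≤ (geo9Y x).holder ε lam + (geo9Y x).supNorm lam :=
    add_nonneg ((modelSignsOn_geo9K x.toKIdx).holder_nonneg ε lam) ((modelSignsOn_geo9K x.toKIdx).supNorm_nonneg lam)
  have hRHS : 0 ≤ wE4₆ (2 * ((d : ℝ) + 1)) Sb M₂ B δc Bε ε * Real.exp (-(4 / 5 * δc * (geo9Y x).dist y y')) *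
      ((geo9Y x).holder ε lam + (geo9Y x).supNorm lam) := mul_nonneg (mul_nonneg hW (Real.exp_pos _).le) hHS
  rcases lam with f | J
  swap
  · rw [KSC₆_e4_inr]; exact hRHS
  have hlam' : (geo9Y x).suppIn (Sum.inl f) y' := hlam
  have hsupN : 0 ≤ (geo9Y x).supNorm (Sum.inl f) := (modelSignsOn_geo9K x.toKIdx).supNorm_nonneg _
  have hhol : 0 ≤ (geo9Y x).holder ε (Sum.inl f) := (modelSignsOn_geo9K x.toKIdx).holder_nonneg ε _
  -- the labelled block of the support and the block support of `coord(f ⊗ E)`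
  set yL : IBondY x.toKIdx := ιB (β x.toKIdx.hN x.toKIdx.D x.toKIdx.hk y') with hyL
  have hyLβ : β x.toKIdx.hN x.toKIdx.D x.toKIdx.hk yL = β x.toKIdx.hN x.toKIdx.D x.toKIdx.hk y' := hι _
  have hlamL : (geo9Y x).suppIn (Sum.inl f) yL := by
    intro w hw; show B6Geom246MultiLevelBox.blkOf x.toKIdx.D.toDomains w = β x.toKIdx.hN x.toKIdx.D x.toKIdx.hk yL
    rw [hyLβ]; exact hlam' w hw
  have hdistL : ∀ t : IBondY x.toKIdx, (geo9Y x).dist t yL = (geo9Y x).dist t y' := fun t => geo9K_dist_congr x.toKIdx rfl hyLβ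
  -- the (3.44) data at the base, in U-letters, on every block
  set Bp : ℝ := max (Bε ε) 0 with hBp
  have hBp0 : 0 ≤ Bp := le_max_right _ _
  have he4U : ∀ (E : BallY 𝔸) (μ ν : Fin (d + 1)) (w : SiteY x.toKIdx),
      ‖cdS x.toKIdx U μ (TU (cdsS x.toKIdx U ν (liftY f (E : 𝔸)))) w‖ ≤
        Bp * Real.exp (-(δc * (geo9Y x).dist (blkC x.toKIdx ιB w) yL)) * ((geo9Y x).holder ε (Sum.inl f) + (geo9Y x).supNorm (Sum.inl f)) := by
    intro E μ ν w
    have hwb : blkY x.toKIdx w = β x.toKIdx.hN x.toKIdx.D x.toKIdx.hk (blkC x.toKIdx ιB w) := (hι _).symm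
    have h := e4_read G x par C37 C38 ((e4Block_KSC₆_iff G x par C37 C38 _).1 hE4) hε0 hε1 f (blkC x.toKIdx ιB w) yL hlamL E μ ν hwb
    refine h.trans ?_
    have hHS' : 0 ≤ (geo9Y x).holder ε (Sum.inl f) + (geo9Y x).supNorm (Sum.inl f) := add_nonneg hhol hsupN
    refine mul_le_mul_of_nonneg_right ?_ hHS'
    have hexp : Real.exp (-(δ * (geo9Y x).dist (blkC x.toKIdx ιB w) yL)) ≤ Real.exp (-(δc * (geo9Y x).dist (blkC x.toKIdx ιB w) yL)) :=
      Real.exp_le_exp.2 (by nlinarith [geo9Y_dist_nonneg x (blkC x.toKIdx ιB w) yL])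
    calc Bε ε * Real.exp (-(δ * (geo9Y x).dist (blkC x.toKIdx ιB w) yL))
        ≤ Bp * Real.exp (-(δ * (geo9Y x).dist (blkC x.toKIdx ιB w) yL)) := mul_le_mul_of_nonneg_right (le_max_left _ _) (Real.exp_pos _).le
      _ ≤ Bp * Real.exp (-(δc * (geo9Y x).dist (blkC x.toKIdx ιB w) yL)) := mul_le_mul_of_nonneg_left hexp hBp0
  -- the backward letter on the left: the exact neighbour identity, at the cost `e^{2(d+1)δc}`
  have he4U' : ∀ (E : BallY 𝔸) (μ ν : Fin (d + 1)) (w : SiteY x.toKIdx),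
      ‖cdsS x.toKIdx U μ (TU (cdsS x.toKIdx U ν (liftY f (E : 𝔸)))) w‖ ≤
        Bp * Real.exp (δc * (2 * ((d : ℝ) + 1))) * Real.exp (-(δc * (geo9Y x).dist (blkC x.toKIdx ιB w) yL)) *
          ((geo9Y x).holder ε (Sum.inl f) + (geo9Y x).supNorm (Sum.inl f)) := by
    intro E μ ν w
    refine (norm_cdsS_le_norm_cdS_symm_shift x.toKIdx U hUu μ _ w).trans ((he4U E μ ν _).trans ?_)
    have hHS' : 0 ≤ (geo9Y x).holder ε (Sum.inl f) + (geo9Y x).supNorm (Sum.inl f) := add_nonneg hhol hsupN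
    refine mul_le_mul_of_nonneg_right ?_ hHS'
    rw [mul_assoc]
    refine mul_le_mul_of_nonneg_left ?_ hBp0
    rw [← Real.exp_add]
    refine Real.exp_le_exp.2 ?_
    have hst := stencilB_blkC x.toKIdx ιB hι μ w
    have htri := geo9Y_dist_triangle x (blkC x.toKIdx ιB w) (blkC x.toKIdx ιB ((shiftY x.toKIdx μ).symm w)) yL
    have h3 : (geo9Y x).dist (blkC x.toKIdx ιB w) yL ≤ 2 * ((d : ℝ) + 1) + (geo9Y x).dist (blkC x.toKIdx ιB ((shiftY x.toKIdx μ).symm w)) yL := by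
      have hst' : (geo9Y x).dist (blkC x.toKIdx ιB w) (blkC x.toKIdx ιB ((shiftY x.toKIdx μ).symm w)) ≤ 2 * ((d : ℝ) + 1) := hst
      linarith
    have h4 := mul_le_mul_of_nonneg_left h3 hδc.le
    rw [mul_add] at h4
    linarith
  -- the (3.44) member of the reading at the product: each value of the ⨆
  rw [KSC₆_e4_inl]
  show (⨆ E : BallY 𝔸, ⨆ μ : Fin (d + 1), supBlkS' x.toKIdx (β x.toKIdx.hN x.toKIdx.D x.toKIdx.hk y)
      (fun ν => cdS x.toKIdx U μ (TW (cdsS x.toKIdx U ν (liftY f (E : 𝔸)))))) ≤ _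
  refine Real.iSup_le (fun E => Real.iSup_le (fun μ => supBlkS'_le x.toKIdx _ _ hRHS fun w ν hw => ?_) hRHS) hRHS
  have hE1 : ‖(E : 𝔸)‖ ≤ 1 := mem_closedBall_zero_iff.1 E.2
  have hwL : blkC x.toKIdx ιB w = ιB (β x.toKIdx.hN x.toKIdx.D x.toKIdx.hk y) := by
    show ιB (blkY x.toKIdx w) = _; rw [show blkY x.toKIdx w = _ from hw]
  have hdistw : (geo9Y x).dist (blkC x.toKIdx ιB w) yL = (geo9Y x).dist y y' := by
    rw [hwL]; exact geo9K_dist_congr x.toKIdx (hι _) hyLβ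
  -- the two letters of the output word, the input, the data
  set Dl : Module.End ℝ (SiteY x.toKIdx × ι → ℝ) := conj b (gradLetterF (shiftY x.toKIdx) (UboxY x.toKIdx U) ((((etaS x.toKIdx : ℝ) : ℂ))⁻¹) μ) with hDl
  set Ds : Module.End ℝ (SiteY x.toKIdx × ι → ℝ) :=
    conj b (diffLetter (shiftY x.toKIdx) (coordC G x.toKIdx (.base U)) ((((geo9Y x).eta : ℂ))⁻¹) (Sum.inr ν)) with hDs
  have hDsU : Ds = conj b (-gradLetterB (shiftY x.toKIdx) (UboxY x.toKIdx U) ((((etaS x.toKIdx : ℝ) : ℂ))⁻¹) ν) := by rw [hDs, hDk, diffLetter_inr]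
  have hDlU : Dl = conj b (diffLetter (shiftY x.toKIdx) (coordC G x.toKIdx (.base U)) ((((geo9Y x).eta : ℂ))⁻¹) (Sum.inl μ)) := by
    rw [hDl, hDk, diffLetter_inl]
  have hmajL : HasMajorant (g := toB6 (geo9Y x) (0 : ℝ) True) (fun p : SiteY x.toKIdx × ι => blkC x.toKIdx ιB p.1) (Dl * GopC x.toKIdx par b (.base U))
      (fun a a' => cR * B₀ * (geo9Y x).len a * Real.exp (-(δc * (geo9Y x).dist a a'))) := by
    rw [hDlU]; exact hasMajorant_mono _ (hm1 (Sum.inl μ)) hlow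
  have hmajR : HasMajorant (g := toB6 (geo9Y x) (0 : ℝ) True) (fun p : SiteY x.toKIdx × ι => blkC x.toKIdx ιB p.1) (GopC x.toKIdx par b (.base U) * Ds)
      (fun a a' => cR * B₀ * (geo9Y x).len a * Real.exp (-(δc * (geo9Y x).dist a a'))) :=
    hasMajorant_mono _ (hm2 (Sum.inr ν)) hlow
  have hBS : BlockSupp (g := toB6 (geo9Y x) (0 : ℝ) True) (fun p : SiteY x.toKIdx × ι => blkC x.toKIdx ιB p.1)
      (coordEquiv b (liftY f (E : 𝔸))) yL (M₂ * (geo9Y x).supNorm (Sum.inl f)) :=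
    blockSupp_coordEquiv_liftY x.toKIdx b ιB hM₂ hrepr f y' hlam' hE1
  set N : ℝ := M₂ * (Bp * Real.exp (δc * (2 * ((d : ℝ) + 1))) * ((geo9Y x).holder ε (Sum.inl f) + (geo9Y x).supNorm (Sum.inl f))) with hN
  have hN0 : 0 ≤ N := by positivity
  have hliftE : (coordEquiv b).symm (coordEquiv b (liftY f (E : 𝔸))) = liftY f (E : 𝔸) := LinearEquiv.symm_apply_apply _ _
  -- (N1) the sup data for every letter on the left
  have hN1 : ∀ (k : Fin (d + 1) ⊕ Fin (d + 1)) (z : SiteY x.toKIdx × ι),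
      |(((conj b (diffLetter (shiftY x.toKIdx) (coordC G x.toKIdx (.base U)) ((((geo9Y x).eta : ℂ))⁻¹) k)) * GopC x.toKIdx par b (.base U) * Ds)
        (coordEquiv b (liftY f (E : 𝔸)))) z| ≤ N * Real.exp (-(δc * (geo9Y x).dist (blkC x.toKIdx ιB z.1) yL)) := by
    intro k z
    refine (abs_apply_le_norm_symm x b hrepr _ z).trans ?_
    rw [hDk, hGopU, hDsU]
    rcases k with μ' | μ'
    · rw [diffLetter_inl, norm_symm_gradF_G_negGradB x b TU U μ' ν _ z.1, hliftE]
      refine (mul_le_mul_of_nonneg_left (he4U E μ' ν z.1) hM₂).trans ?_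
      rw [hN]
      have hone : (1 : ℝ) ≤ Real.exp (δc * (2 * ((d : ℝ) + 1))) := Real.one_le_exp (by positivity)
      have hHS' : 0 ≤ (geo9Y x).holder ε (Sum.inl f) + (geo9Y x).supNorm (Sum.inl f) := add_nonneg hhol hsupN
      have he0 : 0 ≤ Real.exp (-(δc * (geo9Y x).dist (blkC x.toKIdx ιB z.1) yL)) := (Real.exp_pos _).le
      calc M₂ * (Bp * Real.exp (-(δc * (geo9Y x).dist (blkC x.toKIdx ιB z.1) yL)) * ((geo9Y x).holder ε (Sum.inl f) + (geo9Y x).supNorm (Sum.inl f)))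
          = (M₂ * (Bp * 1 * ((geo9Y x).holder ε (Sum.inl f) + (geo9Y x).supNorm (Sum.inl f)))) *
              Real.exp (-(δc * (geo9Y x).dist (blkC x.toKIdx ιB z.1) yL)) := by ring
        _ ≤ (M₂ * (Bp * Real.exp (δc * (2 * ((d : ℝ) + 1))) * ((geo9Y x).holder ε (Sum.inl f) + (geo9Y x).supNorm (Sum.inl f)))) *
              Real.exp (-(δc * (geo9Y x).dist (blkC x.toKIdx ιB z.1) yL)) := by
            refine mul_le_mul_of_nonneg_right (mul_le_mul_of_nonneg_left ?_ hM₂) he0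
            exact mul_le_mul_of_nonneg_right (mul_le_mul_of_nonneg_left hone hBp0) hHS'
    · rw [diffLetter_inr, norm_symm_negGradB_G_negGradB x b TU U μ' ν _ z.1, hliftE]
      refine (mul_le_mul_of_nonneg_left (he4U' E μ' ν z.1) hM₂).trans (le_of_eq ?_)
      rw [hN]; ring
  -- (N2) the sup data of the unperturbed output word
  have hN2 : ∀ z : SiteY x.toKIdx × ι, |((Dl * GopC x.toKIdx par b (.base U) * Ds) (coordEquiv b (liftY f (E : 𝔸)))) z| ≤
      N * Real.exp (-(δc * (geo9Y x).dist (blkC x.toKIdx ιB z.1) yL)) := by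
    intro z
    have h := hN1 (Sum.inl μ) z
    rwa [← hDlU] at h
  -- the transfer and the coordinates of the output word
  have hout := HV Dl Ds hmajL hmajR yL (coordEquiv b (liftY f (E : 𝔸))) _ hBS N hN0 hN1 hN2
  have hval : ‖cdS x.toKIdx U μ (TW (cdsS x.toKIdx U ν (liftY f (E : 𝔸)))) w‖ =
      ‖(coordEquiv b).symm ((Dl * GopC x.toKIdx par b ((codingYx G x C37 C38).bg.mul (.mult a) (.base U)) * Ds)
        (coordEquiv b (liftY f (E : 𝔸)))) w‖ := by
    rw [hGopW, hDsU, hDl, norm_symm_gradF_G_negGradB x b TW U μ ν _ w, hliftE]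
  rw [hval]
  refine (norm_coordEquiv_symm_apply_le x.toKIdx b _ w
    (C := B * (N + M₂ * (geo9Y x).supNorm (Sum.inl f)) * Real.exp (-(4 / 5 * δc * (geo9Y x).dist (blkC x.toKIdx ιB w) yL)))
    fun j => hout (w, j)).trans ?_
  rw [hdistw]
  -- arithmetic: `Σ‖b‖·B·(N + M₂|f|)·e ≦ wE4₆ ε · e · (‖f‖_ε + |f|)`
  have he0 : 0 ≤ Real.exp (-(4 / 5 * δc * (geo9Y x).dist y y')) := (Real.exp_pos _).le
  have hNM : N + M₂ * (geo9Y x).supNorm (Sum.inl f) ≤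
      M₂ * (Bp * Real.exp (δc * (2 * ((d : ℝ) + 1))) + 1) * ((geo9Y x).holder ε (Sum.inl f) + (geo9Y x).supNorm (Sum.inl f)) := by
    rw [hN]
    have h1 : M₂ * (geo9Y x).supNorm (Sum.inl f) ≤ M₂ * ((geo9Y x).holder ε (Sum.inl f) + (geo9Y x).supNorm (Sum.inl f)) :=
      mul_le_mul_of_nonneg_left (le_add_of_nonneg_left hhol) hM₂
    nlinarith
  calc Sb * (B * (N + M₂ * (geo9Y x).supNorm (Sum.inl f)) * Real.exp (-(4 / 5 * δc * (geo9Y x).dist y y')))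
      = (Sb * B) * (N + M₂ * (geo9Y x).supNorm (Sum.inl f)) * Real.exp (-(4 / 5 * δc * (geo9Y x).dist y y')) := by ring
    _ ≤ (Sb * B) * (M₂ * (Bp * Real.exp (δc * (2 * ((d : ℝ) + 1))) + 1) * ((geo9Y x).holder ε (Sum.inl f) + (geo9Y x).supNorm (Sum.inl f))) *
          Real.exp (-(4 / 5 * δc * (geo9Y x).dist y y')) :=
        mul_le_mul_of_nonneg_right (mul_le_mul_of_nonneg_left hNM (mul_nonneg hSb0 hB)) he0
    _ = wE4₆ (2 * ((d : ℝ) + 1)) Sb M₂ B δc Bε ε * Real.exp (-(4 / 5 * δc * (geo9Y x).dist y y')) *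
          ((geo9Y x).holder ε (Sum.inl f) + (geo9Y x).supNorm (Sum.inl f)) := by rw [wE4₆, ← hBp]; ring

end Transfer

/-! ## §5 ★★ The frame instance over the coded carriers of a subfamily and the (3.44) block-steps -/

section Steps

variable [NormOneClass 𝔸] {J : Type} (f : J → MemberY d ℓ hd hL b₀ b₁ Mstar) [∀ x : MemberY d ℓ hd hL b₀ b₁ Mstar, Fintype (geo9Y x).Site]
  [instDS : ∀ x : MemberY d ℓ hd hL b₀ b₁ Mstar, DecidableEq (geo9Y x).Site] [instNE : ∀ x : MemberY d ℓ hd hL b₀ b₁ Mstar, Nonempty (geo9Y x).Site]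
  (c35 : ℝ) (G : Subgroup 𝔸ˣ) (par : ∀ j : J, SiteParY 𝔸 (f j).toKIdx) (OA : ∀ j : J, BondOpY 𝔸 (f j).toKIdx)
  (parB : ∀ j : J, BondParY 𝔸 (f j).toKIdx) {ι : Type} [Fintype ι] [DecidableEq ι] (b : Module.Basis ι ℝ 𝔸)
  (ιB : ∀ j : J, BlkY (f j).toKIdx → IBondY (f j).toKIdx)
  (C37 C38 : ∀ j : J, ℝ → CfgY 𝔸 (f j).toKIdx → AfldY 𝔸 (f j).toKIdx → Prop)
  (Cinv : ∀ j : J, B9.SiteKernel (geo9Y (f j)) (bg9Y 𝔸 G (f j)))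

/-- ★★ **THE (3.44) FRAME OVER THE CODED CARRIERS OF A SUBFAMILY, INHABITED FOR `KSC₆`** (root frame `gpFrame₂CodedOn` with `KSC₆`'s dictionaries, writing function
`wE4₆`, rate `4δc∕5`, transfer field `e4_transfer_KSC₆`); no hypothesis beyond the root frame's.
[cite: Balaban1985BackgroundPropagators, Thm 3.4 p.400, (3.44) p.398, p.403 l.2–5, (3.60)–(3.65) pp.402–403; Balaban1984PropagatorsII, Lemma 2.1 p.234, (2.51)–(2.52) p.232] -/
noncomputable def e4Frame₃CodedOn (hι : ∀ (j : J) (s : BlkY (f j).toKIdx), β (f j).toKIdx.hN (f j).toKIdx.D (f j).toKIdx.hk (ιB j s) = s)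
    (hG1 : ∀ u : 𝔸ˣ, u ∈ G → ‖(u : 𝔸)‖ ≤ 1) (hpar : ∀ j (U : CfgY 𝔸 (f j).toKIdx), GVal G (f j).toKIdx U → ∀ z w, par j U z w ∈ G)
    (hunit : ∀ j (U : CfgY 𝔸 (f j).toKIdx), GVal G (f j).toKIdx U → IsUnit (deltaPrimeAY (f j).toKIdx (par j) U))
    (dB : ℕ) (M₂ : ℝ) (hM₂ : 0 ≤ M₂) (hrepr : ∀ (v : 𝔸) (j : ι), |b.repr v j| ≤ M₂ * ‖v‖) (hcR : 0 < M₂ * ∑ j, ‖b j‖)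
    (Cq : ℝ) (hCq : 0 ≤ Cq) (hC37 : ∀ j β' U a, C37 j β' U a → GVal G (f j).toKIdx U ∧ CplxLettersY G (f j) (par j) (ιB j) Cq β' U a)
    (MInv aInv aW : ℝ) (hMInv : 0 < MInv) (haInv : 0 < aInv) (haW : 0 < aW) :
    E4Frame₃ c35 (fun j => geo9Y (f j)) (fun j => (codingYx G (f j) (C37 j) (C38 j)).bg) (fun j => KSC₆ G (f j) (par j) (C37 j) (C38 j)) b
      (Fin (d + 1)) (fun j => SiteY (f j).toKIdx) :=
  { gpFrame₂CodedOn f c35 G b C37 C38 par ιB (fun j => KSC₆ G (f j) (par j) (C37 j) (C38 j)) hι hG1 hpar hunit dB M₂ hM₂ hrepr Cq hCq hC37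
      (M₂ * ∑ j, ‖b j‖) hcR (fun B _ => (M₂ * ∑ j, ‖b j‖) * B + 1) (fun B _ hB _ => by positivity) (fun δ => δ) (fun δ hδ => hδ)
      MInv aInv aW hMInv haInv haW (fun j => read342Y_KSC₆ G (f j) (par j) b (ιB j) (C37 j) (C38 j) (hι j) M₂ hM₂ hrepr c35 MInv aInv)
      (fun j => write342Y_KSC₆ G (f j) (par j) b (ιB j) (C37 j) (C38 j) (hι j) M₂ hM₂ hrepr aW fun β' U a h => (hC37 j β' U a h).1) with
    wE4 := fun B δc Bε => wE4₆ (2 * ((d : ℝ) + 1)) (∑ j, ‖b j‖) M₂ B δc Bε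
    wE4δ := fun δc => 4 / 5 * δc
    wE4δ_pos := fun δc hδc => by positivity
    e4_transfer := fun j α₀ c c' α₁ B₀ B δ δc Bε hM hα₀ hMa hreg hα₁ haW' h37 hB₀ hB hδ hδc hδcδ hE hE4 HV =>
      e4_transfer_KSC₆ c35 G (f j) (par j) b (ιB j) (C37 j) (C38 j) (hι j) hG1 hM₂ hrepr hcR
        (read342Y_KSC₆ G (f j) (par j) b (ιB j) (C37 j) (C38 j) (hι j) M₂ hM₂ hrepr c35 MInv aInv)
        α₀ c c' α₁ B₀ B δ δc Bε hM hα₀ hMa hreg hα₁ haW' h37 hB₀ hB hδ hδc hδcδ hE hE4 HV }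

/-- ★★ **`StepE4Pos` OF `KSC₆` OVER THE CODED CARRIERS** (any shared `GA`, `Cinv`). [cite: Balaban1985BackgroundPropagators, Thm 3.4 p.400, (3.44) p.398, p.403 l.2–5; Balaban1984PropagatorsII, Lemma 2.1 p.234] -/
theorem stepE4Pos_KSC₆_on (hι : ∀ (j : J) (s : BlkY (f j).toKIdx), β (f j).toKIdx.hN (f j).toKIdx.D (f j).toKIdx.hk (ιB j s) = s)
    (hG1 : ∀ u : 𝔸ˣ, u ∈ G → ‖(u : 𝔸)‖ ≤ 1) (hpar : ∀ j (U : CfgY 𝔸 (f j).toKIdx), GVal G (f j).toKIdx U → ∀ z w, par j U z w ∈ G)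
    (hunit : ∀ j (U : CfgY 𝔸 (f j).toKIdx), GVal G (f j).toKIdx U → IsUnit (deltaPrimeAY (f j).toKIdx (par j) U))
    (dB : ℕ) (M₂ : ℝ) (hM₂ : 0 ≤ M₂) (hrepr : ∀ (v : 𝔸) (j : ι), |b.repr v j| ≤ M₂ * ‖v‖) (hcR : 0 < M₂ * ∑ j, ‖b j‖)
    (Cq : ℝ) (hCq : 0 ≤ Cq) (hC37 : ∀ j β' U a, C37 j β' U a → GVal G (f j).toKIdx U ∧ CplxLettersY G (f j) (par j) (ιB j) Cq β' U a)
    (MInv aInv aW : ℝ) (hMInv : 0 < MInv) (haInv : 0 < aInv) (haW : 0 < aW)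
    (GA : ∀ j : J, B9.KernelFamily (geo9Y (f j)) (codingYx G (f j) (C37 j) (C38 j)).bg)
    (CinvC : ∀ j : J, B9.SiteKernel (geo9Y (f j)) (codingYx G (f j) (C37 j) (C38 j)).bg) :
    StepE4Pos dB c35 (fun j => geo9Y (f j)) (fun j => (codingYx G (f j) (C37 j) (C38 j)).bg) (fun j => KSC₆ G (f j) (par j) (C37 j) (C38 j)) GA CinvC
      (fun j => KSC₆ G (f j) (par j) (C37 j) (C38 j)) :=
  stepE4Pos_of_e4Frame₃ (d := dB)
    (e4Frame₃CodedOn f c35 G par b ιB C37 C38 hι hG1 hpar hunit dB M₂ hM₂ hrepr hcR Cq hCq hC37 MInv aInv aW hMInv haInv haW) GA CinvC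

omit [NormOneClass 𝔸] [FiniteDimensional ℝ 𝔸] [DecidableEq ι] instDS instNE in
/-- ★ **`hin` FOR `KSC₆` WITH POSITIVE OUTPUT CONSTANTS** (input families `(KSCU, KACU, pullS Cinv)`): g11's `hin_KSCU_on_pos` (output `KSC`) followed by the base
congruence `KSC ↦ KSC₆`. [cite: Balaban1985BackgroundPropagators, Thms 3.1–3.3 (3.42)–(3.48) pp.397–399, (3.35) p.396; Balaban1984PropagatorsII, (2.51) p.232] -/
theorem hin_KSC₆_on_pos (hι : ∀ (j : J) (s : BlkY (f j).toKIdx), β (f j).toKIdx.hN (f j).toKIdx.D (f j).toKIdx.hk (ιB j s) = s)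
    (hG1 : ∀ u : 𝔸ˣ, u ∈ G → ‖(u : 𝔸)‖ ≤ 1) {M₂ : ℝ} (hM₂ : 0 ≤ M₂) (hrepr : ∀ (v : 𝔸) (j : ι), |b.repr v j| ≤ M₂ * ‖v‖) (dC : ℕ) :
    ∀ (B₀ δ₀ : ℝ) (Bβ Bε : ℝ → ℝ) (Bεβ : ℝ → ℝ → ℝ) (B₁ δ₁ : ℝ), 0 < B₀ → 0 < δ₀ → 0 < B₁ → 0 < δ₁ →
      ∃ (Mi ai B₀' δ₀' : ℝ) (Bβ' Bε' : ℝ → ℝ) (Bεβ' : ℝ → ℝ → ℝ) (B₁' δ₁' : ℝ), 0 < ai ∧ 0 < B₀' ∧ 0 < δ₀' ∧ 0 < B₁' ∧ 0 < δ₁' ∧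
        ∀ j : J, Mi ≤ (geo9Y (f j)).M → ∀ α₀ : ℝ, 0 < α₀ → (geo9Y (f j)).M * α₀ ≤ ai →
          ∀ c : (codingYx G (f j) (C37 j) (C38 j)).bg.Cfg, (codingYx G (f j) (C37 j) (C38 j)).bg.Reg335 c35 α₀ c →
          B9.Thms31to33IneqAt dC (KSCU G (f j) (par j) (C37 j) (C38 j)) (KACU G (f j) (OA j) (parB j) (C37 j) (C38 j))
              (pullS (codingYx G (f j) (C37 j) (C38 j)) (Cinv j)) B₀ δ₀ Bβ Bε Bεβ B₁ δ₁ c →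
          B9.Thms31to33IneqAt dC (KSC₆ G (f j) (par j) (C37 j) (C38 j)) (KACU G (f j) (OA j) (parB j) (C37 j) (C38 j))
              (pullS (codingYx G (f j) (C37 j) (C38 j)) (Cinv j)) B₀' δ₀' Bβ' Bε' Bεβ' B₁' δ₁' c := by
  intro B₀ δ₀ Bβ Bε Bεβ B₁ δ₁ hB₀ hδ₀ hB₁ hδ₁
  obtain ⟨Mi, ai, B₀', δ₀', Bβ', Bε', Bεβ', B₁', δ₁', hai, hB₀', hδ₀', hB₁', hδ₁', H⟩ :=
    hin_KSCU_on_pos f c35 G par OA parB b ιB C37 C38 Cinv hι hG1 hM₂ hrepr dC B₀ δ₀ Bβ Bε Bεβ B₁ δ₁ hB₀ hδ₀ hB₁ hδ₁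
  refine ⟨Mi, ai, B₀', δ₀', Bβ', Bε', Bεβ', B₁', δ₁', hai, hB₀', hδ₀', hB₁', hδ₁', fun j hM α₀ hα₀ hMa c hreg hT => ?_⟩
  obtain ⟨U, rfl, -⟩ := (codingYx G (f j) (C37 j) (C38 j)).exists_of_bg_Reg335 hreg
  obtain ⟨⟨h42, h43⟩, hC, hG⟩ := H j hM α₀ hα₀ hMa _ hreg hT
  obtain ⟨se, sh1, se4, sh2, sl2, sg⟩ := KSC₆_members_base G (f j) (par j) (C37 j) (C38 j) U
  exact ⟨⟨ineq342_346_347_congr G (f j) (C37 j) (C38 j) _ _ (fun n => (se n).symm) (fun n => (sl2 n).symm) (fun n => (sg n).symm) _ _ h42,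
    ineq343_345_congr G (f j) (C37 j) (C38 j) _ _ sh1.symm se4.symm sh2.symm _ _ _ _ h43⟩, hC, hG⟩

/-- ★★ **`StepE4Pos` OF `KSCU` OVER THE CODED CARRIER — THE (3.44) MEMBER OF THE SECT.-B STEP OF RECORD IN PRINT's READING (R13-U1), G′ SIDE** (input
families `(KSCU, KACU, pullS Cinv)`, output `KSCU`'s (3.44) block at the product): `stepE4Pos_KSC₆_on` (with `GA := KACU`, `Cinv := pullS Cinv`) transported
by `stepE4Pos_of_family_pos` — `hin_KSC₆_on_pos`, identity output (`KSC₆.e4 = KSCU.e4`).  Binders = those of `B9SectBStepsKSCUBlocks.stepEPos_KSCU_on`.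
[cite: Balaban1985BackgroundPropagators, Thm 3.4 p.400, (3.44) p.398, p.403 l.2–5, (3.60)–(3.65) pp.402–403, (3.35)–(3.37) p.396; Balaban1984PropagatorsII, Lemma 2.1 p.234, (2.51)–(2.52) p.232] -/
theorem stepE4Pos_KSCU_on (hι : ∀ (j : J) (s : BlkY (f j).toKIdx), β (f j).toKIdx.hN (f j).toKIdx.D (f j).toKIdx.hk (ιB j s) = s)
    (hG1 : ∀ u : 𝔸ˣ, u ∈ G → ‖(u : 𝔸)‖ ≤ 1) (hpar : ∀ j (U : CfgY 𝔸 (f j).toKIdx), GVal G (f j).toKIdx U → ∀ z w, par j U z w ∈ G)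
    (hunit : ∀ j (U : CfgY 𝔸 (f j).toKIdx), GVal G (f j).toKIdx U → IsUnit (deltaPrimeAY (f j).toKIdx (par j) U))
    (dB : ℕ) (M₂ : ℝ) (hM₂ : 0 ≤ M₂) (hrepr : ∀ (v : 𝔸) (j : ι), |b.repr v j| ≤ M₂ * ‖v‖) (hcR : 0 < M₂ * ∑ j, ‖b j‖)
    (Cq : ℝ) (hCq : 0 ≤ Cq) (hC37 : ∀ j β' U a, C37 j β' U a → GVal G (f j).toKIdx U ∧ CplxLettersY G (f j) (par j) (ιB j) Cq β' U a)
    (MInv aInv aW : ℝ) (hMInv : 0 < MInv) (haInv : 0 < aInv) (haW : 0 < aW) :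
    StepE4Pos dB c35 (fun j => geo9Y (f j)) (fun j => (codingYx G (f j) (C37 j) (C38 j)).bg)
      (fun j => KSCU G (f j) (par j) (C37 j) (C38 j)) (fun j => KACU G (f j) (OA j) (parB j) (C37 j) (C38 j))
      (fun j => pullS (codingYx G (f j) (C37 j) (C38 j)) (Cinv j)) (fun j => KSCU G (f j) (par j) (C37 j) (C38 j)) :=
  stepE4Pos_of_family_pos dB c35 (fun j => geo9Y (f j)) (fun j => (codingYx G (f j) (C37 j) (C38 j)).bg)
    (fun j => KSC₆ G (f j) (par j) (C37 j) (C38 j)) (fun j => KSCU G (f j) (par j) (C37 j) (C38 j))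
    (fun j => KACU G (f j) (OA j) (parB j) (C37 j) (C38 j)) (fun j => KACU G (f j) (OA j) (parB j) (C37 j) (C38 j))
    (fun j => pullS (codingYx G (f j) (C37 j) (C38 j)) (Cinv j))
    (fun j => KSC₆ G (f j) (par j) (C37 j) (C38 j)) (fun j => KSCU G (f j) (par j) (C37 j) (C38 j))
    (hin_KSC₆_on_pos f c35 G par OA parB b ιB C37 C38 Cinv hι hG1 hM₂ hrepr dB)
    (fun Bε δ a hδ ha => ⟨0, 1, a, Bε, δ, one_pos, ha, le_rfl, hδ, fun j _ _ _ _ _ _ _ _ _ _ _ h => (e4Block_KSC₆_iff G (f j) (par j) (C37 j) (C38 j) _).1 h⟩)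
    (stepE4Pos_KSC₆_on f c35 G par b ιB C37 C38 hι hG1 hpar hunit dB M₂ hM₂ hrepr hcR Cq hCq hC37 MInv aInv aW hMInv haInv haW _ _)

end Steps

end Literature.MathematicalPhysics.QuantumFieldTheory.Balaban1983to89.B9SectBE4FrameCodedY

end
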